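import Literature.NumberTheory.LFunctions.DirichletLTruncationCertificatesOdd
import Literature.NumberTheory.LFunctions.DirichletLTruncationCertificatesMean
import HarnessLib

/-!
# No real zero for the ODD real primitive characters of conductor `751 ≤ q ≤ 800`, in the kernel
# (truncation certificates with drift)

Topic `Literature/NumberTheory/LFunctions`; namespace `Literature.NumberTheory.LFunctions`
(private per-modulus work in `Literature.NumberTheory.LFunctions.OddTruncationIIb`). THEOREMS only (no
definition, no named fact, no `sorry`): **`noRealZeroOdd_range_751_800`** — for every modulus
`751 ≤ q ≤ 800`, every primitive quadratic ODD `χ` mod `q` (imaginary quadratic fields of discriminant `−q`)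
and every `σ ∈ (0, 1)`, `L(σ, χ) ≠ 0`.

Per modulus (one bullet each, in the order of `interval_cases`): moduli without a primitive quadratic
character are dismissed (`q ≡ 2 (mod 4)`, `16 ∣ q`, `p² ∣ q` — MV Thm 9.13); the EVEN primitive quadratic
character is excluded by the parity test inside `LTruncationCert.good_odd_of_*`; the ODD one is certified by
**`LTruncationCert.certDriftOK v q K J P`** (`DirichletLTruncationCertificatesOdd.lean`): the truncation
`∑_{n ≤ Kq} χ(n) n^{−σ}` after `K` periods dominates the one-sided second-order tail bound `B⁻/(2(Kq+1)^{3/2})`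
(`B⁻ = max_N (−U(N))⁺`; the drift `U(q) = q·h(−q) > 0` only helps) on each of `J` cells covering `[1/2, 1]`,
and the functional equation reflects `(0, 1/2)` to `(1/2, 1)`.  15 certificates in this file (parameters
and margins in the docstrings; `K > 1` / `J > 16` only where the one-period truncation is too small at
`σ = 1/2`). [cite: Chua2005RealZeros, §2.2 ALGO 1]

## References

* K. S. Chua, *Real zeros of Dedekind zeta functions of real quadratic fields*, Math. Comp. 74 (2005)
  1457–1470, §2. [Chua2005RealZeros]
* M. Watkins, *Real zeros of real odd Dirichlet L-functions*, Math. Comp. 73 (2004) 415–423.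
  [Watkins2004RealZeros]
* H. L. Montgomery, R. C. Vaughan, *Multiplicative Number Theory I*, CUP 2007, §9.3 Thm 9.13, §10.1.
  [MontgomeryVaughan2007]
-/

namespace Literature.NumberTheory.LFunctions

namespace OddTruncationIIb

open FeketePolyaKernel PrimitiveQuadratic LTruncationCert

/-- Conductor `≡ 2 (mod 4)`: no primitive character (private copy of the sweep-4 lemma).
[cite: MontgomeryVaughan2007, §9.3 Theorem 9.13] -/
private theorem absurd_of_mod_four_two {q : ℕ} [NeZero q] (hq : q % 4 = 2)
    {χ : DirichletCharacter ℂ q} (hprim : χ.IsPrimitive) : False := by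
  obtain ⟨m, rfl⟩ : ∃ m, q = 2 * m := ⟨q / 2, by omega⟩
  haveI : NeZero m := ⟨by omega⟩
  exact not_isPrimitive_two_mul (m := m) (Nat.odd_iff.mpr (by omega)) hprim

/-- Conductor divisible by `16`: no primitive quadratic character (private copy).
[cite: MontgomeryVaughan2007, §9.3 Theorem 9.13] -/
private theorem absurd_of_sixteen_dvd {q : ℕ} [NeZero q] (hq : q % 16 = 0) {χ : DirichletCharacter ℂ q}
    (hprim : χ.IsPrimitive) (hquad : χ.IsQuadratic) : False := by
  obtain ⟨k, m, hm, rfl⟩ := Nat.exists_eq_two_pow_mul_odd (NeZero.ne q)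
  have hm2 := Nat.odd_iff.mp hm
  haveI : NeZero m := ⟨by omega⟩
  have hk := le_three_of_level_two_pow_mul hm hprim hquad
  interval_cases k <;> norm_num at hq <;> omega

/-- Conductor with an odd square factor `p²`: no primitive quadratic character (private copy).
[cite: MontgomeryVaughan2007, §9.3 Theorem 9.13] -/
private theorem absurd_of_sq_dvd {q : ℕ} [NeZero q] {p : ℕ} (hp : p.Prime) (hp2 : p ≠ 2)
    (hpq : p * p ∣ q) {χ : DirichletCharacter ℂ q} (hprim : χ.IsPrimitive) (hquad : χ.IsQuadratic) :
    False := by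
  obtain ⟨k, m, hm, rfl⟩ := Nat.exists_eq_two_pow_mul_odd (NeZero.ne q)
  have hm2 := Nat.odd_iff.mp hm
  haveI : NeZero m := ⟨by omega⟩
  have hsq := squarefree_of_level_two_pow_mul hm hprim hquad
  have hp2' : Nat.Coprime p 2 := (Nat.coprime_primes hp Nat.prime_two).mpr hp2
  have hcop : Nat.Coprime (p * p) (2 ^ k) := Nat.Coprime.pow_right k (Nat.Coprime.mul_left hp2' hp2')
  have hpm : p * p ∣ m := hcop.dvd_of_dvd_mul_left hpq
  exact hp.one_lt.ne' (Nat.isUnit_iff.mp (hsq p hpm))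

/-- `751`: the odd character `(·/751)` = `χ_{−751}` — drift certificate `K = 1`, `J = 16`, `P = 32` (`B⁻ = 0`, worst cell margin `1.414`). [cite: Chua2005RealZeros, §2.2 ALGO 1] -/
private theorem goodOdd751 :
    ∀ χ : DirichletCharacter ℂ 751, χ.IsQuadratic → χ.IsPrimitive → χ.Odd →
      ∀ σ : ℝ, 0 < σ → σ < 1 → χ.LFunction σ ≠ 0 :=
  good_odd_of_odd (by decide) (by decide) 1 16 32 (by decide +kernel)

/-- `755`: the odd character `(·/755)` = `χ_{−755}` — drift certificate `K = 1`, `J = 16`, `P = 32` (`B⁻ = 0`, worst cell margin `1.135`). [cite: Chua2005RealZeros, §2.2 ALGO 1] -/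
private theorem goodOdd755 :
    ∀ χ : DirichletCharacter ℂ 755, χ.IsQuadratic → χ.IsPrimitive → χ.Odd →
      ∀ σ : ℝ, 0 < σ → σ < 1 → χ.LFunction σ ≠ 0 :=
  good_odd_of_odd (by decide) (by decide) 1 16 32 (by decide +kernel)

/-- `759`: the odd character `(·/759)` = `χ_{−759}` — drift certificate `K = 1`, `J = 16`, `P = 32` (`B⁻ = 0`, worst cell margin `2.281`). [cite: Chua2005RealZeros, §2.2 ALGO 1] -/
private theorem goodOdd759 :
    ∀ χ : DirichletCharacter ℂ 759, χ.IsQuadratic → χ.IsPrimitive → χ.Odd →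
      ∀ σ : ℝ, 0 < σ → σ < 1 → χ.LFunction σ ≠ 0 :=
  good_odd_of_odd (by decide) (by decide) 1 16 32 (by decide +kernel)

/-- `760`: the odd character `χ₈·(·/95)` = `χ_{−760}` — MEAN certificate `K = 1`, `J = 16`, `P = 32` (`U(q) = 3040` = `q·h(−760)`, worst cell margin `0.093`; the plain truncation at `σ = 1/2` is too small here). [cite: Chua2005RealZeros, §2.2 ALGO 1] -/
private theorem goodOdd760 :
    ∀ χ : DirichletCharacter ℂ 760, χ.IsQuadratic → χ.IsPrimitive → χ.Odd →
      ∀ σ : ℝ, 0 < σ → σ < 1 → χ.LFunction σ ≠ 0 :=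
  good_odd_of_eight_mean (by decide) (by decide) 1 16 32 (by decide +kernel) (by decide +kernel)

/-- `763`: the odd character `(·/763)` = `χ_{−763}` — drift certificate `K = 1`, `J = 16`, `P = 32` (`B⁻ = 412`, worst cell margin `0.326`). [cite: Chua2005RealZeros, §2.2 ALGO 1] -/
private theorem goodOdd763 :
    ∀ χ : DirichletCharacter ℂ 763, χ.IsQuadratic → χ.IsPrimitive → χ.Odd →
      ∀ σ : ℝ, 0 < σ → σ < 1 → χ.LFunction σ ≠ 0 :=
  good_odd_of_odd (by decide) (by decide) 1 16 32 (by decide +kernel)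

/-- `767`: the odd character `(·/767)` = `χ_{−767}` — drift certificate `K = 1`, `J = 16`, `P = 32` (`B⁻ = 0`, worst cell margin `2.069`). [cite: Chua2005RealZeros, §2.2 ALGO 1] -/
private theorem goodOdd767 :
    ∀ χ : DirichletCharacter ℂ 767, χ.IsQuadratic → χ.IsPrimitive → χ.Odd →
      ∀ σ : ℝ, 0 < σ → σ < 1 → χ.LFunction σ ≠ 0 :=
  good_odd_of_odd (by decide) (by decide) 1 16 32 (by decide +kernel)

/-- `771`: the odd character `(·/771)` = `χ_{−771}` — drift certificate `K = 1`, `J = 16`, `P = 32` (`B⁻ = 51`, worst cell margin `0.538`). [cite: Chua2005RealZeros, §2.2 ALGO 1] -/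
private theorem goodOdd771 :
    ∀ χ : DirichletCharacter ℂ 771, χ.IsQuadratic → χ.IsPrimitive → χ.Odd →
      ∀ σ : ℝ, 0 < σ → σ < 1 → χ.LFunction σ ≠ 0 :=
  good_odd_of_odd (by decide) (by decide) 1 16 32 (by decide +kernel)

/-- `772 = 4·193`: the odd character `χ₋₄·(·/193)` = `χ_{−772}` — drift certificate `K = 1`, `J = 16`, `P = 32` (`B⁻ = 494`, worst cell margin `0.051`). [cite: Chua2005RealZeros, §2.2 ALGO 1] -/
private theorem goodOdd772 :
    ∀ χ : DirichletCharacter ℂ 772, χ.IsQuadratic → χ.IsPrimitive → χ.Odd →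
      ∀ σ : ℝ, 0 < σ → σ < 1 → χ.LFunction σ ≠ 0 :=
  good_odd_of_four (by decide) (by decide) 1 16 32 (by decide +kernel)

/-- `776 = 8·97`: the odd character `χ₋₈·(·/97)` = `χ_{−776}` — drift certificate `K = 1`, `J = 16`, `P = 32` (`B⁻ = 0`, worst cell margin `1.879`); the other primitive quadratic character mod `776` is even (parity test). [cite: Chua2005RealZeros, §2.2 ALGO 1] -/
private theorem goodOdd776 :
    ∀ χ : DirichletCharacter ℂ 776, χ.IsQuadratic → χ.IsPrimitive → χ.Odd →
      ∀ σ : ℝ, 0 < σ → σ < 1 → χ.LFunction σ ≠ 0 :=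
  good_odd_of_eight (by decide) (by decide) 1 16 32 (by decide +kernel) (by decide +kernel)

/-- `779`: the odd character `(·/779)` = `χ_{−779}` — drift certificate `K = 1`, `J = 16`, `P = 32` (`B⁻ = 0`, worst cell margin `0.921`). [cite: Chua2005RealZeros, §2.2 ALGO 1] -/
private theorem goodOdd779 :
    ∀ χ : DirichletCharacter ℂ 779, χ.IsQuadratic → χ.IsPrimitive → χ.Odd →
      ∀ σ : ℝ, 0 < σ → σ < 1 → χ.LFunction σ ≠ 0 :=
  good_odd_of_odd (by decide) (by decide) 1 16 32 (by decide +kernel)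

/-- `787`: the odd character `(·/787)` = `χ_{−787}` — drift certificate `K = 1`, `J = 16`, `P = 32` (`B⁻ = 239`, worst cell margin `0.444`). [cite: Chua2005RealZeros, §2.2 ALGO 1] -/
private theorem goodOdd787 :
    ∀ χ : DirichletCharacter ℂ 787, χ.IsQuadratic → χ.IsPrimitive → χ.Odd →
      ∀ σ : ℝ, 0 < σ → σ < 1 → χ.LFunction σ ≠ 0 :=
  good_odd_of_odd (by decide) (by decide) 1 16 32 (by decide +kernel)

/-- `788 = 4·197`: the odd character `χ₋₄·(·/197)` = `χ_{−788}` — drift certificate `K = 1`, `J = 16`, `P = 32` (`B⁻ = 16`, worst cell margin `0.904`). [cite: Chua2005RealZeros, §2.2 ALGO 1] -/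
private theorem goodOdd788 :
    ∀ χ : DirichletCharacter ℂ 788, χ.IsQuadratic → χ.IsPrimitive → χ.Odd →
      ∀ σ : ℝ, 0 < σ → σ < 1 → χ.LFunction σ ≠ 0 :=
  good_odd_of_four (by decide) (by decide) 1 16 32 (by decide +kernel)

/-- `791`: the odd character `(·/791)` = `χ_{−791}` — drift certificate `K = 1`, `J = 16`, `P = 32` (`B⁻ = 0`, worst cell margin `2.992`). [cite: Chua2005RealZeros, §2.2 ALGO 1] -/
private theorem goodOdd791 :
    ∀ χ : DirichletCharacter ℂ 791, χ.IsQuadratic → χ.IsPrimitive → χ.Odd →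
      ∀ σ : ℝ, 0 < σ → σ < 1 → χ.LFunction σ ≠ 0 :=
  good_odd_of_odd (by decide) (by decide) 1 16 32 (by decide +kernel)

/-- `795`: the odd character `(·/795)` = `χ_{−795}` — drift certificate `K = 1`, `J = 16`, `P = 32` (`B⁻ = 376`, worst cell margin `0.121`). [cite: Chua2005RealZeros, §2.2 ALGO 1] -/
private theorem goodOdd795 :
    ∀ χ : DirichletCharacter ℂ 795, χ.IsQuadratic → χ.IsPrimitive → χ.Odd →
      ∀ σ : ℝ, 0 < σ → σ < 1 → χ.LFunction σ ≠ 0 :=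
  good_odd_of_odd (by decide) (by decide) 1 16 32 (by decide +kernel)

/-- `799`: the odd character `(·/799)` = `χ_{−799}` — drift certificate `K = 1`, `J = 16`, `P = 32` (`B⁻ = 0`, worst cell margin `1.463`). [cite: Chua2005RealZeros, §2.2 ALGO 1] -/
private theorem goodOdd799 :
    ∀ χ : DirichletCharacter ℂ 799, χ.IsQuadratic → χ.IsPrimitive → χ.Odd →
      ∀ σ : ℝ, 0 < σ → σ < 1 → χ.LFunction σ ≠ 0 :=
  good_odd_of_odd (by decide) (by decide) 1 16 32 (by decide +kernel)

/-- **No real zero in `(0, 1)` for every odd real primitive character of conductor `751 ≤ q ≤ 800`**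
(one bullet per modulus, in the order of `interval_cases`). [cite: Chua2005RealZeros, §2.2 ALGO 1] -/
theorem range_751_800 (q : ℕ) [NeZero q] (hlo : 750 < q) (hhi : q ≤ 800) :
    ∀ χ : DirichletCharacter ℂ q, χ.IsQuadratic → χ.IsPrimitive → χ.Odd →
      ∀ σ : ℝ, 0 < σ → σ < 1 → χ.LFunction σ ≠ 0 := by
  interval_cases q
  · exact goodOdd751 -- certificate
  · -- 16 ∣ 752: no primitive quadratic character
    exact fun χ hquad hprim _ ↦ (absurd_of_sixteen_dvd (by decide) hprim hquad).elim
  · -- 753 ≡ 1 (mod 4): the primitive quadratic character (·/753) is even (parity test)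
    exact good_odd_of_odd (by decide) (by decide) 1 16 32 (by decide +kernel)
  · -- 754 ≡ 2 (mod 4): no primitive character
    exact fun χ _ hprim _ ↦ (absurd_of_mod_four_two (by decide) hprim).elim
  · exact goodOdd755 -- certificate
  · -- 3² ∣ 756: no primitive quadratic character
    exact fun χ hquad hprim _ ↦
      (absurd_of_sq_dvd (p := 3) (by norm_num) (by decide) (by decide) hprim hquad).elim
  · -- 757 ≡ 1 (mod 4): the primitive quadratic character (·/757) is even (parity test)
    exact good_odd_of_odd (by decide) (by decide) 1 16 32 (by decide +kernel)
  · -- 758 ≡ 2 (mod 4): no primitive character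
    exact fun χ _ hprim _ ↦ (absurd_of_mod_four_two (by decide) hprim).elim
  · exact goodOdd759 -- certificate
  · exact goodOdd760 -- mean certificate
  · -- 761 ≡ 1 (mod 4): the primitive quadratic character (·/761) is even (parity test)
    exact good_odd_of_odd (by decide) (by decide) 1 16 32 (by decide +kernel)
  · -- 762 ≡ 2 (mod 4): no primitive character
    exact fun χ _ hprim _ ↦ (absurd_of_mod_four_two (by decide) hprim).elim
  · exact goodOdd763 -- certificate
  · -- 764 = 4·191, 191 ≡ 3 (mod 4): the primitive quadratic character is even (parity test)
    exact good_odd_of_four (by decide) (by decide) 1 16 32 (by decide +kernel)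
  · -- 3² ∣ 765: no primitive quadratic character
    exact fun χ hquad hprim _ ↦
      (absurd_of_sq_dvd (p := 3) (by norm_num) (by decide) (by decide) hprim hquad).elim
  · -- 766 ≡ 2 (mod 4): no primitive character
    exact fun χ _ hprim _ ↦ (absurd_of_mod_four_two (by decide) hprim).elim
  · exact goodOdd767 -- certificate
  · -- 16 ∣ 768: no primitive quadratic character
    exact fun χ hquad hprim _ ↦ (absurd_of_sixteen_dvd (by decide) hprim hquad).elim
  · -- 769 ≡ 1 (mod 4): the primitive quadratic character (·/769) is even (parity test)
    exact good_odd_of_odd (by decide) (by decide) 1 16 32 (by decide +kernel)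
  · -- 770 ≡ 2 (mod 4): no primitive character
    exact fun χ _ hprim _ ↦ (absurd_of_mod_four_two (by decide) hprim).elim
  · exact goodOdd771 -- certificate
  · exact goodOdd772 -- certificate
  · -- 773 ≡ 1 (mod 4): the primitive quadratic character (·/773) is even (parity test)
    exact good_odd_of_odd (by decide) (by decide) 1 16 32 (by decide +kernel)
  · -- 774 ≡ 2 (mod 4): no primitive character
    exact fun χ _ hprim _ ↦ (absurd_of_mod_four_two (by decide) hprim).elim
  · -- 5² ∣ 775: no primitive quadratic character
    exact fun χ hquad hprim _ ↦
      (absurd_of_sq_dvd (p := 5) (by norm_num) (by decide) (by decide) hprim hquad).elim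
  · exact goodOdd776 -- certificate
  · -- 777 ≡ 1 (mod 4): the primitive quadratic character (·/777) is even (parity test)
    exact good_odd_of_odd (by decide) (by decide) 1 16 32 (by decide +kernel)
  · -- 778 ≡ 2 (mod 4): no primitive character
    exact fun χ _ hprim _ ↦ (absurd_of_mod_four_two (by decide) hprim).elim
  · exact goodOdd779 -- certificate
  · -- 780 = 4·195, 195 ≡ 3 (mod 4): the primitive quadratic character is even (parity test)
    exact good_odd_of_four (by decide) (by decide) 1 16 32 (by decide +kernel)
  · -- 781 ≡ 1 (mod 4): the primitive quadratic character (·/781) is even (parity test)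
    exact good_odd_of_odd (by decide) (by decide) 1 16 32 (by decide +kernel)
  · -- 782 ≡ 2 (mod 4): no primitive character
    exact fun χ _ hprim _ ↦ (absurd_of_mod_four_two (by decide) hprim).elim
  · -- 3² ∣ 783: no primitive quadratic character
    exact fun χ hquad hprim _ ↦
      (absurd_of_sq_dvd (p := 3) (by norm_num) (by decide) (by decide) hprim hquad).elim
  · -- 16 ∣ 784: no primitive quadratic character
    exact fun χ hquad hprim _ ↦ (absurd_of_sixteen_dvd (by decide) hprim hquad).elim
  · -- 785 ≡ 1 (mod 4): the primitive quadratic character (·/785) is even (parity test)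
    exact good_odd_of_odd (by decide) (by decide) 1 16 32 (by decide +kernel)
  · -- 786 ≡ 2 (mod 4): no primitive character
    exact fun χ _ hprim _ ↦ (absurd_of_mod_four_two (by decide) hprim).elim
  · exact goodOdd787 -- certificate
  · exact goodOdd788 -- certificate
  · -- 789 ≡ 1 (mod 4): the primitive quadratic character (·/789) is even (parity test)
    exact good_odd_of_odd (by decide) (by decide) 1 16 32 (by decide +kernel)
  · -- 790 ≡ 2 (mod 4): no primitive character
    exact fun χ _ hprim _ ↦ (absurd_of_mod_four_two (by decide) hprim).elim
  · exact goodOdd791 -- certificate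
  · -- 3² ∣ 792: no primitive quadratic character
    exact fun χ hquad hprim _ ↦
      (absurd_of_sq_dvd (p := 3) (by norm_num) (by decide) (by decide) hprim hquad).elim
  · -- 793 ≡ 1 (mod 4): the primitive quadratic character (·/793) is even (parity test)
    exact good_odd_of_odd (by decide) (by decide) 1 16 32 (by decide +kernel)
  · -- 794 ≡ 2 (mod 4): no primitive character
    exact fun χ _ hprim _ ↦ (absurd_of_mod_four_two (by decide) hprim).elim
  · exact goodOdd795 -- certificate
  · -- 796 = 4·199, 199 ≡ 3 (mod 4): the primitive quadratic character is even (parity test)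
    exact good_odd_of_four (by decide) (by decide) 1 16 32 (by decide +kernel)
  · -- 797 ≡ 1 (mod 4): the primitive quadratic character (·/797) is even (parity test)
    exact good_odd_of_odd (by decide) (by decide) 1 16 32 (by decide +kernel)
  · -- 798 ≡ 2 (mod 4): no primitive character
    exact fun χ _ hprim _ ↦ (absurd_of_mod_four_two (by decide) hprim).elim
  · exact goodOdd799 -- certificate
  · -- 16 ∣ 800: no primitive quadratic character
    exact fun χ hquad hprim _ ↦ (absurd_of_sixteen_dvd (by decide) hprim hquad).elim

end OddTruncationIIb

open OddTruncationIIb in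
/-- **Odd real primitive characters of conductor `751 ≤ q ≤ 800` have no real zero in `(0, 1)`.**
[cite: Watkins2004RealZeros, main theorem (d ≤ 3·10⁸, here re-proved in the kernel for this range)] -/
theorem noRealZeroOdd_range_751_800 (q : ℕ) [NeZero q] (hlo : 750 < q) (hhi : q ≤ 800) :
    ∀ χ : DirichletCharacter ℂ q, χ.IsQuadratic → χ.IsPrimitive → χ.Odd →
      ∀ σ : ℝ, 0 < σ → σ < 1 → χ.LFunction σ ≠ 0 :=
  range_751_800 q hlo hhi

end Literature.NumberTheory.LFunctions
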